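/-
Copyright (c) 2026 the pub-hodgecm-mathlib formalisation cell (harness21).  Prover seat hodgecm-mathlib-B-p14 (g36): road «S3-tree» (chair F0P3a-plan (g11); T10-42 (3) S3-res capital),
brick T1e «VALENCIES», TAME RAMIFIED EDITION R3 = the star of a type-two vertex at a tamely ramified place has `q + 1` vertices; 2026-09-01.  Twin of ★ V3 `UnitaryLatticeTreeTypeTwoStarCount`.
-/
import Literature.NumberTheory.Automorphic.UnitaryLatticeTreeStarOfInvolution              -- ★ T1e R1 (B-p14 (g36)): datum-free stars by type, `mem_neighborSet_N₁_iff_of_v`, transport `…_of_htr₂`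
import Literature.NumberTheory.Automorphic.UnitaryLatticeTreeTypeTwoStarCount              -- ★ T1e V3 (B-p14 (g36)): `vec_sub_smul_vec`, `N₁_lt_N₁_sup_span_vec` (datum-free parts reused)
import Literature.NumberTheory.Automorphic.UnitaryLatticeTreeFixedCostarCoordsRamified     -- ★ (F0P3a-p07 (g11)): `dualLatt_N₁_of_v`, `isSelfDualLattice_N₁_sup_span_vec_of_neg`
import Literature.NumberTheory.Automorphic.UnitaryLatticeTreeTypeTwoTransitiveRamified     -- ★ htr₂-ram (F0P3a-p07 (g11)): `isVertexLattice_two_N₁_of_neg`, `forall_isVertexLattice_two_exists_mapGL_N₁_eq_of_neg`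
import Literature.NumberTheory.Automorphic.UnitaryLatticeTreeResiduallyUnipotentCorner     -- ★ S-a3 (F0P3a-p07 (g11)): `residue_eq_zero_iff_v_lt_one`, `residue_eq_of_v_sub_lt_one`
import HarnessLib

/-!
# The lattice graph of a hermitian space — T1e FILE R3: THE STAR OF A TYPE-TWO VERTEX AT A TAMELY RAMIFIED PLACE — `#star(N₁) = |ℙ¹(𝓀)| = q + 1`
# (Tits 1979 §2.4 / §3.5; Bruhat–Tits 1972 §10; Serre, *Trees* II.1.1)

Topic `NumberTheory/Automorphic`; namespace `Literature.NumberTheory.Automorphic.UnitaryLatticeTree`.  THEOREMS ONLY (no definition, no instance, no notation, no named fact,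
no `sorry`); kernel lane.  Cell `pub/hodgecm-mathlib` (D-0151), crux H413 = `stmt-HodgeConjecture-24833`; road «S3-tree», brick T1e «VALENCIES», TAME RAMIFIED EDITION (S3-res
capital, chair T10-42 (3)).  ★ V3 counts the star of the type-two vertex `N₁ = latt diag(1,1,ϖ)` under the UNRAMIFIED datum: the neighbours are the self-dual `N₁ + 𝒪w(a,b)`,
`w(a,b) = (a∕ϖ, 0, b)`, `(a,b)` primitive ISOTROPIC, in bijection with `Option {t | σk t + t = 0}`.  At a TAMELY RAMIFIED place (`σ` valuation-preserving, `σϖ = −ϖ`, residually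
trivial: `hres`) the residual pairing on `N₁^♯ ∕ N₁` is ALTERNATING, so EVERY primitive `(a,b)` gives a self-dual neighbour (★ `isSelfDualLattice_N₁_sup_span_vec_of_neg`, F0P3a-p07):
the star of `N₁` is the whole projective line `ℙ¹(𝓀)`, `#star(N₁) = #(Option 𝓀) = q + 1`, `q = |𝓀[K]|`.  With ★ R2b (`#star(L₀) = q + 1`) this is the local index `(q+1, q+1)` of the
ramified quasi-split `U(3)` [Tits1979, §2.4]: the tree is `(q+1)`-REGULAR.

* §1 `exists_eq_N₁_sup_span_vec_of_lt_of_neg` (exhaustion: a self-dual `L > N₁` is `N₁ + 𝒪w(a,b)`, `(a,b)` primitive), **`mem_neighborSet_N₁_iff_exists_vec_of_neg`**.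
* §2 **`natCard_neighborSet_N₁_eq_of_neg`** (`Nat.card star(N₁) = Nat.card (Option 𝓀[K])`, any residue field).
* §3 `finite_neighborSet_N₁_of_neg`, **`ncard_neighborSet_N₁_of_neg`** (`= Nat.card 𝓀[K] + 1`), `finite_neighborSet_of_isVertexLattice_two_of_neg`, **`ncard_neighborSet_of_isVertexLattice_two_of_neg`**
  (every type-two vertex, given the transitivity binder `htr₂`), **`ncard_neighborSet_of_isVertexLattice_two_of_ramified`** (`htr₂` discharged by ★ `forall_isVertexLattice_two_exists_mapGL_N₁_eq_of_neg`
  under its `h2`, `hnorm`).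

HONEST LABEL: HC_CM is proved only modulo the 2 remaining named inputs (hLiu418 24832, h413 24833) until rung 0 closes; nothing printed is asserted here; ramified places belong to
the residue letter S3-res.

## References
* [Tits1979] J. Tits, *Reductive groups over local fields*, PSPM 33.1 (1979), §2.4 (ramified quasi-split `U(3)`: local index `(q+1, q+1)`), §3.5.
* [BruhatTits1972] F. Bruhat, J. Tits, *Groupes réductifs sur un corps local I*, Publ. Math. IHÉS 41 (1972), §10.
* [Serre1980Trees] J.-P. Serre, *Trees* (1980), Ch. II §1.1 (neighbours of a vertex ↔ points of the projective line over the residue field).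
* [Jacobowitz1962] R. Jacobowitz, *Hermitian forms over local fields*, Amer. J. Math. 84 (1962), §7–§8.
-/

set_option autoImplicit false

noncomputable section

open scoped Valued WithZero Matrix MatrixGroups

namespace Literature.NumberTheory.Automorphic.UnitaryLatticeTree

open Literature.NumberTheory.Automorphic Literature.NumberTheory.Automorphic.HermitianLattice
open Literature.NumberTheory.Automorphic.CartanUnique

variable {K : Type*} [Field K] [Valued K ℤᵐ⁰] {σ : K →+* K} {ϖ : K}

/-! ## §1 Exhaustion of the star of `N₁` at a tamely ramified place -/

/-- **EXHAUSTION OF THE STAR OF `N₁` (tamely ramified)**: a self-dual vertex `L > N₁` is `N₁ + 𝒪w(a,b)` for a PRIMITIVE integral pair `(a,b)` — `L ≤ L^♯ ≤ N₁^♯ = latt diag(ϖ⁻¹,1,1)`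
(★ `dualLatt_N₁_of_v`), a vector of `L ∖ N₁` reduces to a primitive `w(a,b) ∈ L` (★ `sub_vec_mem_N₁_of_mem_dual`), and `N₁ + 𝒪w(a,b) ≤ L` are two self-dual vertices
(★ `isSelfDualLattice_N₁_sup_span_vec_of_neg` — no isotropy condition at a ramified place), equal by (D2). [cite: BruhatTits1972, §10] [cite: Jacobowitz1962, §7–§8] [cite: Serre1980Trees, II.1.1] -/
theorem exists_eq_N₁_sup_span_vec_of_lt_of_neg (hvσ : ∀ a, Valued.v (σ a) = Valued.v a) (hσϖ : σ ϖ = -ϖ) (hϖ : Valued.v ϖ = WithZero.exp (-1 : ℤ)) (hres : ∀ x : K, Valued.v x ≤ 1 → Valued.v (σ x - x) < 1) {L : Submodule 𝒪[K] (Fin 3 → K)}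
    (hL : IsSelfDualLattice σ ϖ ((StdForm.antidiagonal 3).over K) L) (hlt : latt (Matrix.diagonal ![(1 : K), 1, ϖ]) < L) :
    ∃ a b : K, Valued.v a ≤ 1 ∧ Valued.v b ≤ 1 ∧ (Valued.v a = 1 ∨ Valued.v b = 1) ∧
      L = latt (Matrix.diagonal ![(1 : K), 1, ϖ]) ⊔ Submodule.span 𝒪[K] {(![a / ϖ, 0, b] : Fin 3 → K)} := by
  have hϖ0 : ϖ ≠ 0 := uniformizer_ne_zero hϖ
  -- `L ≤ L^♯ ≤ N₁^♯ = latt diag(ϖ⁻¹, 1, 1)`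
  have hLd : L ≤ latt (Matrix.diagonal ![ϖ⁻¹, (1 : K), 1]) :=
    calc L ≤ dualLatt σ ((StdForm.antidiagonal 3).over K) L := le_dualLatt_of_isVertexLattice hvσ hL
      _ ≤ dualLatt σ ((StdForm.antidiagonal 3).over K) (latt (Matrix.diagonal ![(1 : K), 1, ϖ])) := dualLatt_antitone σ _ hlt.le
      _ = latt (Matrix.diagonal ![ϖ⁻¹, (1 : K), 1]) := dualLatt_N₁_of_v hvσ hϖ0
  obtain ⟨w, hwL, hwN⟩ := SetLike.exists_of_lt hlt
  obtain ⟨ha, hb, hsub⟩ := sub_vec_mem_N₁_of_mem_dual hϖ (hLd hwL)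
  -- `w(a,b) ∈ L`, primitive
  have hw'L : (![ϖ * w 0 / ϖ, 0, w 2] : Fin 3 → K) ∈ L := by
    have h : w - (w - ![ϖ * w 0 / ϖ, 0, w 2]) ∈ L := Submodule.sub_mem _ hwL (hlt.le hsub)
    rwa [sub_sub_cancel] at h
  have hprim : Valued.v (ϖ * w 0) = 1 ∨ Valued.v (w 2) = 1 := by
    by_contra h
    push Not at h
    have hmem : (![ϖ * w 0 / ϖ, 0, w 2] : Fin 3 → K) ∈ latt (Matrix.diagonal ![(1 : K), 1, ϖ]) :=
      (vec_mem_N₁_iff hϖ _ _).2 ⟨lt_of_le_of_ne ha h.1, lt_of_le_of_ne hb h.2⟩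
    have hw : w ∈ latt (Matrix.diagonal ![(1 : K), 1, ϖ]) := by
      have := Submodule.add_mem _ hsub hmem
      rwa [sub_add_cancel] at this
    exact hwN hw
  -- `N₁ + 𝒪w(a,b) ≤ L`, both self-dual
  have hL' := isSelfDualLattice_N₁_sup_span_vec_of_neg hvσ hσϖ hϖ hres ha hb hprim
  have hle : latt (Matrix.diagonal ![(1 : K), 1, ϖ]) ⊔ Submodule.span 𝒪[K] {(![ϖ * w 0 / ϖ, 0, w 2] : Fin 3 → K)} ≤ L :=
    sup_le hlt.le (Submodule.span_le.2 (Set.singleton_subset_iff.2 hw'L))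
  exact ⟨ϖ * w 0, w 2, ha, hb, hprim, (eq_of_le_of_isVertexLattice hvσ hϖ0 hL' hL hle).symm⟩

/-- **`star(N₁) = {N₁ + 𝒪w(a,b) | (a,b) ∈ 𝒪² primitive}` at a tamely ramified place** — the whole projective line. [cite: BruhatTits1972, §10] [cite: Tits1979, §3.5] [cite: Serre1980Trees, II.1.1] -/
theorem mem_neighborSet_N₁_iff_exists_vec_of_neg (hvσ : ∀ a, Valued.v (σ a) = Valued.v a) (hσϖ : σ ϖ = -ϖ) (hϖ : Valued.v ϖ = WithZero.exp (-1 : ℤ)) (hres : ∀ x : K, Valued.v x ≤ 1 → Valued.v (σ x - x) < 1)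
    (w : {M : Submodule 𝒪[K] (Fin 3 → K) // IsVertex σ ϖ ((StdForm.antidiagonal 3).over K) M}) :
    w ∈ (latticeGraph σ ϖ ((StdForm.antidiagonal 3).over K)).neighborSet ⟨latt (Matrix.diagonal ![(1 : K), 1, ϖ]), 2, isVertexLattice_two_N₁_of_neg hσϖ hϖ⟩ ↔
      ∃ a b : K, Valued.v a ≤ 1 ∧ Valued.v b ≤ 1 ∧ (Valued.v a = 1 ∨ Valued.v b = 1) ∧
        w.1 = latt (Matrix.diagonal ![(1 : K), 1, ϖ]) ⊔ Submodule.span 𝒪[K] {(![a / ϖ, 0, b] : Fin 3 → K)} := by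
  rw [mem_neighborSet_N₁_iff_of_v hvσ hϖ (isVertexLattice_two_N₁_of_neg hσϖ hϖ)]
  constructor
  · intro hlt
    have h0 : IsSelfDualLattice σ ϖ ((StdForm.antidiagonal 3).over K) w.1 :=
      (isVertexLattice_two_and_isSelfDualLattice_of_lt_of_v hvσ hϖ ⟨2, isVertexLattice_two_N₁_of_neg hσϖ hϖ⟩ w.2 hlt).2
    exact exists_eq_N₁_sup_span_vec_of_lt_of_neg hvσ hσϖ hϖ hres h0 hlt
  · rintro ⟨a, b, -, -, hprim, hw⟩
    rw [hw]
    exact N₁_lt_N₁_sup_span_vec hϖ hprim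

/-! ## §2 The bijection with `ℙ¹(𝓀) = Option 𝓀`: `[0:1]`, `[1:t]` -/

/-- **THE STAR OF `N₁` ↔ THE PROJECTIVE LINE OVER THE RESIDUE FIELD (tamely ramified place)**: `#star(N₁) = #(Option 𝓀[K])` — the point `[0:1]` (the neighbour `N₁ + 𝒪e₂ = L₀`) and the
points `[1:t]`, `t ∈ 𝓀` (the neighbours `N₁ + 𝒪w(1,B)`, `B` any lift of `t`).  Valid for ANY residue field. [cite: BruhatTits1972, §10] [cite: Tits1979, §2.4] [cite: Serre1980Trees, II.1.1] -/
theorem natCard_neighborSet_N₁_eq_of_neg (hvσ : ∀ a, Valued.v (σ a) = Valued.v a) (hσϖ : σ ϖ = -ϖ) (hϖ : Valued.v ϖ = WithZero.exp (-1 : ℤ)) (hres : ∀ x : K, Valued.v x ≤ 1 → Valued.v (σ x - x) < 1) :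
    Nat.card ((latticeGraph σ ϖ ((StdForm.antidiagonal 3).over K)).neighborSet ⟨latt (Matrix.diagonal ![(1 : K), 1, ϖ]), 2, isVertexLattice_two_N₁_of_neg hσϖ hϖ⟩) = Nat.card (Option 𝓀[K]) := by
  classical
  have h0 : Valued.v (0 : K) < 1 := by rw [map_zero]; exact zero_lt_one
  obtain ⟨lift, hlift⟩ : ∃ lift : 𝓀[K] → 𝒪[K], ∀ a, IsLocalRing.residue 𝒪[K] (lift a) = a :=
    ⟨Function.surjInv IsLocalRing.residue_surjective, Function.surjInv_eq IsLocalRing.residue_surjective⟩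
  -- the normalised pairs `(a_p, b_p)`: `(0, 1)` and `(1, lift t)`
  let aOf : Option 𝓀[K] → K := fun p => p.elim 0 fun _ => 1
  let bOf : Option 𝓀[K] → K := fun p => p.elim 1 fun t => (lift t : K)
  have ha_none : aOf none = 0 := rfl
  have hb_none : bOf none = 1 := rfl
  have ha_some : ∀ t, aOf (some t) = 1 := fun _ => rfl
  have hb_some : ∀ t, bOf (some t) = (lift t : K) := fun _ => rfl
  have ha : ∀ p, Valued.v (aOf p) ≤ 1 := by
    rintro (_ | t)
    · rw [ha_none, map_zero]; exact zero_le_one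
    · rw [ha_some, map_one]
  have hb : ∀ p, Valued.v (bOf p) ≤ 1 := by
    rintro (_ | t)
    · rw [hb_none, map_one]
    · rw [hb_some]; exact (lift t).2
  have hprim : ∀ p, Valued.v (aOf p) = 1 ∨ Valued.v (bOf p) = 1 := by
    rintro (_ | t)
    · exact Or.inr (by rw [hb_none, map_one])
    · exact Or.inl (by rw [ha_some, map_one])
  -- the vertices `N₁ + 𝒪w(a_p, b_p)` of the star: ALL self-dual at a ramified place
  have hsd : ∀ p, IsSelfDualLattice σ ϖ ((StdForm.antidiagonal 3).over K)
      (latt (Matrix.diagonal ![(1 : K), 1, ϖ]) ⊔ Submodule.span 𝒪[K] {(![aOf p / ϖ, 0, bOf p] : Fin 3 → K)}) := fun p =>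
    isSelfDualLattice_N₁_sup_span_vec_of_neg hvσ hσϖ hϖ hres (ha p) (hb p) (hprim p)
  let f : Option 𝓀[K] → (latticeGraph σ ϖ ((StdForm.antidiagonal 3).over K)).neighborSet ⟨latt (Matrix.diagonal ![(1 : K), 1, ϖ]), 2, isVertexLattice_two_N₁_of_neg hσϖ hϖ⟩ := fun p =>
    ⟨⟨latt (Matrix.diagonal ![(1 : K), 1, ϖ]) ⊔ Submodule.span 𝒪[K] {(![aOf p / ϖ, 0, bOf p] : Fin 3 → K)}, 0, hsd p⟩,
      (mem_neighborSet_N₁_iff_of_v hvσ hϖ (isVertexLattice_two_N₁_of_neg hσϖ hϖ) _).2 (N₁_lt_N₁_sup_span_vec hϖ (hprim p))⟩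
  have hf : ∀ p, (f p).1.1 = latt (Matrix.diagonal ![(1 : K), 1, ϖ]) ⊔ Submodule.span 𝒪[K] {(![aOf p / ϖ, 0, bOf p] : Fin 3 → K)} := fun _ => rfl
  -- `w(a_p, b_p)` is level one over `N₁`
  have hlev : ∀ p, ϖ • (![aOf p / ϖ, 0, bOf p] : Fin 3 → K) ∈ latt (Matrix.diagonal ![(1 : K), 1, ϖ]) := fun p => smul_ϖ_vec_mem_N₁ hϖ (ha p) (hb p)
  have hnot : ∀ p, (![aOf p / ϖ, 0, bOf p] : Fin 3 → K) ∉ latt (Matrix.diagonal ![(1 : K), 1, ϖ]) := fun p hmem => by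
    obtain ⟨h1, h2⟩ := (vec_mem_N₁_iff hϖ _ _).1 hmem
    rcases hprim p with h | h
    · exact absurd h h1.ne
    · exact absurd h h2.ne
  refine (Nat.card_congr (Equiv.ofBijective f ⟨?_, ?_⟩)).symm
  · -- injective: equal lattices ⇒ proportional residual pairs ⇒ equal normalised parameters
    intro p p' hpp'
    have hEq : (f p').1.1 = (f p).1.1 := by rw [hpp']
    rw [hf, hf] at hEq
    obtain ⟨c, hc, hmem⟩ := (sup_span_eq_sup_span_iff hϖ (hlev p) (hnot p')).1 hEq
    rw [vec_sub_smul_vec, vec_mem_N₁_iff hϖ] at hmem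
    obtain ⟨h1, h2⟩ := hmem
    rcases p with _ | t <;> rcases p' with _ | t'
    · rfl
    · rw [ha_none, ha_some, mul_zero, sub_zero, map_one] at h1
      exact absurd h1 (lt_irrefl 1)
    · rw [ha_some, ha_none, mul_one, zero_sub, Valuation.map_neg, hc] at h1
      exact absurd h1 (lt_irrefl 1)
    · rw [ha_some, ha_some, mul_one] at h1
      rw [hb_some, hb_some] at h2
      -- `|B′ − B| ≤ max(|B′ − cB|, |(c − 1)B|) < 1`
      have h3 : Valued.v ((lift t' : K) - (lift t : K)) < 1 := by
        have e : (lift t' : K) - (lift t : K) = ((lift t' : K) - c * (lift t : K)) + (c - 1) * (lift t : K) := by ring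
        rw [e]
        refine (Valuation.map_add _ _ _).trans_lt (max_lt h2 ?_)
        rw [map_mul, ← Valuation.map_neg, neg_sub]
        calc Valued.v (1 - c) * Valued.v (lift t : K) ≤ Valued.v (1 - c) * 1 := mul_le_mul_right (lift t).2 _
          _ < 1 := by rw [mul_one]; exact h1
      have h4 := residue_eq_of_v_sub_lt_one h3
      rw [hlift, hlift] at h4
      subst h4
      rfl
  · -- surjective: every vertex of the star is `N₁ + 𝒪w(a_p, b_p)` for a normalised `p`
    rintro ⟨w, hw⟩
    obtain ⟨a, b, ha', hb', hprim', hw1⟩ := (mem_neighborSet_N₁_iff_exists_vec_of_neg hvσ hσϖ hϖ hres w).1 hw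
    -- it suffices to exhibit `p` and a unit `c` with `w(a,b) − c·w(a_p,b_p) ∈ N₁`
    have key : ∀ p (c : K), Valued.v c = 1 → Valued.v (a - c * aOf p) < 1 → Valued.v (b - c * bOf p) < 1 → f p = ⟨w, hw⟩ := by
      intro p c hc h1 h2
      apply Subtype.ext; apply Subtype.ext
      rw [hf, hw1]
      refine (sup_span_eq_sup_span_of_sub_mem hc ?_).symm
      rw [vec_sub_smul_vec, vec_mem_N₁_iff hϖ]
      exact ⟨h1, h2⟩
    by_cases ha1 : Valued.v a = 1
    · -- `|a| = 1`: `p = [1 : b∕a]`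
      have hBint : Valued.v (b / a) ≤ 1 := by rw [map_div₀, ha1, div_one]; exact hb'
      set B : 𝒪[K] := ⟨b / a, hBint⟩ with hBdef
      refine ⟨some (IsLocalRing.residue 𝒪[K] B), key _ a ha1 ?_ ?_⟩
      · rw [ha_some, mul_one, sub_self]; exact h0
      · rw [hb_some]
        have e : b - a * (lift (IsLocalRing.residue 𝒪[K] B) : K) = a * ((B : K) - (lift (IsLocalRing.residue 𝒪[K] B) : K)) := by
          have ha0 : a ≠ 0 := fun h => by rw [h, map_zero] at ha1; exact zero_ne_one ha1
          change b - a * _ = a * (b / a - _)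
          field_simp
        rw [e, map_mul, ha1, one_mul, show (B : K) - (lift (IsLocalRing.residue 𝒪[K] B) : K) = ((B - lift (IsLocalRing.residue 𝒪[K] B) : 𝒪[K]) : K) from rfl,
          ← residue_eq_zero_iff_v_lt_one, map_sub, hlift, sub_self]
    · -- `|a| < 1`: then `|b| = 1` and `p = [0 : 1]`
      have hb1 : Valued.v b = 1 := hprim'.resolve_left ha1
      refine ⟨none, key none b hb1 ?_ ?_⟩
      · rw [ha_none, mul_zero, sub_zero]; exact lt_of_le_of_ne ha' ha1
      · rw [hb_none, mul_one, sub_self]; exact h0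

/-! ## §3 The counts: `q + 1` neighbours at every type-two vertex of the tame-ramified tree -/

/-- **The star of `N₁` is finite** (tamely ramified place; finite residue field). [cite: BruhatTits1972, §10] [cite: Serre1980Trees, II.1.1] -/
theorem finite_neighborSet_N₁_of_neg (hvσ : ∀ a, Valued.v (σ a) = Valued.v a) (hσϖ : σ ϖ = -ϖ) (hϖ : Valued.v ϖ = WithZero.exp (-1 : ℤ)) (hres : ∀ x : K, Valued.v x ≤ 1 → Valued.v (σ x - x) < 1) [Finite 𝓀[K]] :
    ((latticeGraph σ ϖ ((StdForm.antidiagonal 3).over K)).neighborSet ⟨latt (Matrix.diagonal ![(1 : K), 1, ϖ]), 2, isVertexLattice_two_N₁_of_neg hσϖ hϖ⟩).Finite := by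
  have h := natCard_neighborSet_N₁_eq_of_neg hvσ hσϖ hϖ hres
  rw [Finite.card_option] at h
  exact Set.finite_coe_iff.1 (Nat.finite_of_card_ne_zero (by rw [h]; exact Nat.succ_ne_zero _))

/-- **`#star(N₁) = q + 1` AT A TAMELY RAMIFIED PLACE** (`q = |𝓀[K]|`): the points of `ℙ¹(𝓀)`. [cite: Tits1979, §2.4] [cite: BruhatTits1972, §10] [cite: Serre1980Trees, II.1.1] -/
theorem ncard_neighborSet_N₁_of_neg (hvσ : ∀ a, Valued.v (σ a) = Valued.v a) (hσϖ : σ ϖ = -ϖ) (hϖ : Valued.v ϖ = WithZero.exp (-1 : ℤ)) (hres : ∀ x : K, Valued.v x ≤ 1 → Valued.v (σ x - x) < 1) [Finite 𝓀[K]] :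
    ((latticeGraph σ ϖ ((StdForm.antidiagonal 3).over K)).neighborSet ⟨latt (Matrix.diagonal ![(1 : K), 1, ϖ]), 2, isVertexLattice_two_N₁_of_neg hσϖ hϖ⟩).ncard = Nat.card 𝓀[K] + 1 := by
  rw [← Nat.card_coe_set_eq, natCard_neighborSet_N₁_eq_of_neg hvσ hσϖ hϖ hres, Finite.card_option]

/-- **The star of every type-two vertex is finite** (tamely ramified place, finite residue field; given the transitivity binder `htr₂`, ★ at tame places by
`forall_isVertexLattice_two_exists_mapGL_N₁_eq_of_neg`). [cite: BruhatTits1972, §10] -/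
theorem finite_neighborSet_of_isVertexLattice_two_of_neg (hvσ : ∀ a, Valued.v (σ a) = Valued.v a) (hσϖ : σ ϖ = -ϖ) (hϖ : Valued.v ϖ = WithZero.exp (-1 : ℤ)) (hres : ∀ x : K, Valued.v x ≤ 1 → Valued.v (σ x - x) < 1) [Finite 𝓀[K]]
    (htr₂ : ∀ M : Submodule 𝒪[K] (Fin 3 → K), IsVertexLattice σ ϖ ((StdForm.antidiagonal 3).over K) 2 M → ∃ u : unitaryGroupOfForm σ ((StdForm.antidiagonal 3).over K), M = mapGL (u : GL (Fin 3) K) (latt (Matrix.diagonal ![(1 : K), 1, ϖ])))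
    (v : {M : Submodule 𝒪[K] (Fin 3 → K) // IsVertex σ ϖ ((StdForm.antidiagonal 3).over K) M}) (hv : IsVertexLattice σ ϖ ((StdForm.antidiagonal 3).over K) 2 v.1) :
    ((latticeGraph σ ϖ ((StdForm.antidiagonal 3).over K)).neighborSet v).Finite :=
  (finite_neighborSet_iff_N₁_of_htr₂ (isVertexLattice_two_N₁_of_neg hσϖ hϖ) htr₂ v hv).2 (finite_neighborSet_N₁_of_neg hvσ hσϖ hϖ hres)

/-- **EVERY TYPE-TWO VERTEX OF THE TAME-RAMIFIED `U(3)` TREE HAS EXACTLY `q + 1` NEIGHBOURS** (`q = |𝓀[K]|`; given the transitivity binder `htr₂`): the second half of the local index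
`(q+1, q+1)` of [Tits1979, §2.4]. [cite: Tits1979, §2.4] [cite: BruhatTits1972, §10] [cite: Serre1980Trees, II.1.1] -/
theorem ncard_neighborSet_of_isVertexLattice_two_of_neg (hvσ : ∀ a, Valued.v (σ a) = Valued.v a) (hσϖ : σ ϖ = -ϖ) (hϖ : Valued.v ϖ = WithZero.exp (-1 : ℤ)) (hres : ∀ x : K, Valued.v x ≤ 1 → Valued.v (σ x - x) < 1) [Finite 𝓀[K]]
    (htr₂ : ∀ M : Submodule 𝒪[K] (Fin 3 → K), IsVertexLattice σ ϖ ((StdForm.antidiagonal 3).over K) 2 M → ∃ u : unitaryGroupOfForm σ ((StdForm.antidiagonal 3).over K), M = mapGL (u : GL (Fin 3) K) (latt (Matrix.diagonal ![(1 : K), 1, ϖ])))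
    (v : {M : Submodule 𝒪[K] (Fin 3 → K) // IsVertex σ ϖ ((StdForm.antidiagonal 3).over K) M}) (hv : IsVertexLattice σ ϖ ((StdForm.antidiagonal 3).over K) 2 v.1) :
    ((latticeGraph σ ϖ ((StdForm.antidiagonal 3).over K)).neighborSet v).ncard = Nat.card 𝓀[K] + 1 := by
  rw [ncard_neighborSet_eq_ncard_neighborSet_N₁_of_htr₂ (isVertexLattice_two_N₁_of_neg hσϖ hϖ) htr₂ v hv, ncard_neighborSet_N₁_of_neg hvσ hσϖ hϖ hres]

/-- **EVERY TYPE-TWO VERTEX OF THE TAME-RAMIFIED `U(3)` TREE HAS EXACTLY `q + 1` NEIGHBOURS — `htr₂` discharged**: `σ` an involution preserving `v` with `σϖ = −ϖ`, residually trivial,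
`|2| = 1`, and the norm `z ↦ zσz` hitting every `σ`-fixed one-unit to first order (`hnorm`, Hensel); ★ `forall_isVertexLattice_two_exists_mapGL_N₁_eq_of_neg` (F0P3a-p07) supplies `htr₂`.
[cite: Tits1979, §2.4] [cite: Jacobowitz1962, §8] [cite: BruhatTits1972, §10] -/
theorem ncard_neighborSet_of_isVertexLattice_two_of_ramified (hσ : ∀ x, σ (σ x) = x) (hvσ : ∀ a, Valued.v (σ a) = Valued.v a) (hσϖ : σ ϖ = -ϖ) (hϖ : Valued.v ϖ = WithZero.exp (-1 : ℤ)) (hres : ∀ x : K, Valued.v x ≤ 1 → Valued.v (σ x - x) < 1) (h2 : Valued.v (2 : K) = 1)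
    (hnorm : ∀ u : K, σ u = u → Valued.v (u - 1) < 1 → ∃ z : K, z * σ z = u ∧ Valued.v (z - 1) ≤ Valued.v (u - 1)) [Finite 𝓀[K]]
    (v : {M : Submodule 𝒪[K] (Fin 3 → K) // IsVertex σ ϖ ((StdForm.antidiagonal 3).over K) M}) (hv : IsVertexLattice σ ϖ ((StdForm.antidiagonal 3).over K) 2 v.1) :
    ((latticeGraph σ ϖ ((StdForm.antidiagonal 3).over K)).neighborSet v).ncard = Nat.card 𝓀[K] + 1 :=
  ncard_neighborSet_of_isVertexLattice_two_of_neg hvσ hσϖ hϖ hres (forall_isVertexLattice_two_exists_mapGL_N₁_eq_of_neg hσ hvσ hϖ hσϖ hres h2 hnorm) v hv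

end Literature.NumberTheory.Automorphic.UnitaryLatticeTree

end
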